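import Literature.MathematicalPhysics.QuantumFieldTheory.ConformalBootstrap3D.MixedOddTail
import Literature.MathematicalPhysics.QuantumFieldTheory.ConformalBootstrap3D.HRCoeffABIntervalBounds

/-!
# Odd-sector light-block cells of a mixed `σ–ε` point certificate

`MixedOddTail` dominates the `ℤ₂`-odd form by the evaluation `𝔇[gpm]` of the reflection-positive
`εσσε` block alone, `oddForm(gmm, gpm) ≥ 𝔇[gpm] = Σ_{(n,j)} (A_{n,j}(c,c;Δ,ℓ)/λ_ℓ) 𝔇[𝒫_{Δ+n,j}]`,
`c = (Δ_σ-Δ_ε)/2`, `A(c,c) ≥ 0`, and closes the TAIL `Δ ≥ E₀` termwise. This file closes the LIGHT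
odd-sector blocks — obligations (D2) `σ` itself at `(Δ_σ, 0)`, (D3) scalars on `[3, E₀)`, (D4) every
spin `ℓ ≥ 1` (both parities) on `[ℓ+1, E₀)` of `MixedObligations` — by HEAD CELLS of `𝔇`, the exact
analogue of the single-correlator interval head cells (`cell_of_headNumberI`): on a `Δ`-cell `[a, b)`
the finitely many head terms `(n, j) ∈ headSet ℓ n_F` are bounded below by
`min(Lo·Φlo, Hi·Φlo)` with the coefficient enclosures `Lo/Hi = hrCoeffABLo/Hi c₁ c₂ a b ℓ n j`
(`HRCoeffABIntervalBounds`, box `c ∈ [c₁, c₂]`) and the two-weight corner bound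
`Φlo = cornerBound₂ (w⁴-w⁵-|w³|) (w⁴+w⁵+|w³|) j (a+n) (b+n) σ_lo σ_hi ≤ 𝔇[𝒫_{Δ+n,j}]`, while every
term off the head set lies in the tail domain `E ≥ a + n_F + 1 ≥ E₀` where (M_odd)/(T_odd) apply.
One rational number per cell (`oddHeadNumber ≥ 0`) then gives `OddPositive` at EVERY `Δ ∈ [a, b)`
for every `(Δ_σ, Δ_ε) ∈ Q` (`oddCell_of_headNumber`; non-regular points by right limits inside the
cell). With these cells an island certificate's odd sector is entirely closed-form: only the even
light blocks (E2)–(E4) remain evaluator hypotheses. The domination is a relaxation (the `σεσε` row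
enters at its Cauchy–Schwarz worst case), so a functional found by a solver must be searched with
this constraint in place. [cite: KosPolandSimmonsduffin2014, §3.3 eq. (3.16)]
-/

noncomputable section

namespace Literature.MathematicalPhysics.QuantumFieldTheory.ConformalBootstrap3D

open Finset Set Filter Topology

/-! ### Head + tail for the dominating evaluation -/

/-- Pair-indexed `z`-series of `𝔇[g^{-d,d}_{Δ,ℓ}]` at a regular `(Δ, ℓ)`.
[cite: DolanOsborn2004, §3 eqs. (3.10)–(3.12)] -/
theorem hasSum_oddDomEval_ofPoints_pairs {N : ℕ} (z zb : Fin N → ℝ) (w : Fin 5 → Fin N → ℝ)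
    (hz : ∀ k, z k ∈ Ioo (0 : ℝ) 1) (hzb : ∀ k, zb k ∈ Ioo (0 : ℝ) 1) (t : ℝ) {d Δ : ℝ} {ℓ : ℕ}
    {g₂ : ℝ → ℝ → ℝ} (hΔ : unitarityBound3D ℓ < Δ) (hreg : ¬ accidentalDegeneracy3D Δ ℓ)
    (hg₂ : IsConformalBlock3D (-d) d Δ ℓ g₂) :
    HasSum (fun q : ℕ × ℕ => hrCoeffAB (d / 2) (d / 2) Δ ℓ q.1 q.2 / legendreLam ℓ *
        oddDomEval z zb w t (zMono (Δ + (q.1 : ℝ)) q.2)) (oddDomEval z zb w t g₂) := by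
  have h4 := hasSum_pointFunctional_crossF_hrZAB (w 3) z zb hz hzb t (-1) hΔ hreg rfl hg₂
  have h5 := hasSum_pointFunctional_crossF_hrZAB (w 4) z zb hz hzb t 1 hΔ hreg rfl hg₂
  have h2 := hasSum_pointFunctional_crossF_hrZAB (fun k => |w 2 k|) z zb hz hzb t 1 hΔ hreg rfl hg₂
  have hs := (h4.sub h5).sub h2
  unfold oddDomEval
  refine hs.congr_fun fun q => ?_
  ring

/-- **Odd-sector positivity from a finite head + non-negative tail of `𝔇`.** At a regular `(Δ, ℓ)`
above the bound (`Δ ≠ 1` if `ℓ = 0`): if `Σ_{(n,j) ∈ F} (A_{n,j}(c,c)/λ_ℓ) 𝔇[𝒫_{Δ+n,j}] ≥ 0` and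
`𝔇[𝒫_{Δ+n,j}] ≥ 0` off `F` on the descendant range, then `OddPositive` at `(Δ, ℓ)`.
[cite: PappadopuloRychkovEspinRattazzi2012, §5] -/
theorem oddPositive_ofPoints_of_dom_head {N : ℕ} (z zb : Fin N → ℝ) (w : Fin 5 → Fin N → ℝ)
    (hz : ∀ k, z k ∈ Ioo (0 : ℝ) 1) (hzb : ∀ k, zb k ∈ Ioo (0 : ℝ) 1) {Δσ Δε Δ : ℝ} {ℓ : ℕ}
    (hΔ : unitarityBound3D ℓ < Δ) (hreg : ¬ accidentalDegeneracy3D Δ ℓ) (h1 : ℓ = 0 → Δ ≠ 1)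
    (F : Finset (ℕ × ℕ))
    (hhead : 0 ≤ ∑ q ∈ F, hrCoeffAB ((Δσ - Δε) / 2) ((Δσ - Δε) / 2) Δ ℓ q.1 q.2 / legendreLam ℓ *
      oddDomEval z zb w Δσ (zMono (Δ + (q.1 : ℝ)) q.2))
    (htail : ∀ q : ℕ × ℕ, q ∉ F → InDescendantRange ℓ q.1 q.2 →
      0 ≤ oddDomEval z zb w Δσ (zMono (Δ + (q.1 : ℝ)) q.2)) :
    (CrossingFunctional.ofPoints z zb w).OddPositive Δσ Δε Δ ℓ := by
  intro g₁ g₂ hg₁ hg₂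
  refine le_trans ?_ (oddDomEval_le_oddForm_ofPoints z zb w hz hzb hΔ hreg h1 hg₁ hg₂)
  have hS := hasSum_oddDomEval_ofPoints_pairs z zb w hz hzb Δσ (d := Δσ - Δε) hΔ hreg hg₂
  refine hhead.trans (sum_le_hasSum F (fun q hq => ?_) hS)
  by_cases hr : InDescendantRange ℓ q.1 q.2
  · exact mul_nonneg (div_nonneg (hrCoeffAB_self_nonneg _ hΔ _ _) (legendreLam_pos ℓ).le)
      (htail q hq hr)
  · rw [hrCoeffAB_eq_zero_of_not_inDescendantRange _ _ Δ hr, zero_div, zero_mul]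

/-! ### Head cells with the AB interval tables -/

/-- The odd head-cell sum: `Σ_{(n,j) ∈ F} min(Lo Φlo, Hi Φlo)` with
`Lo/Hi = hrCoeffABLo/Hi c₁ c₂ a b ℓ n j`. [cite: DolanOsborn2004, §3 eq. (3.12)] -/
def oddHeadCellSumI (ℓ : ℕ) (c₁ c₂ a b : ℝ) (F : Finset (ℕ × ℕ)) (Φlo : ℕ × ℕ → ℝ) : ℝ :=
  ∑ q ∈ F, min (hrCoeffABLo c₁ c₂ a b ℓ q.1 q.2 * Φlo q) (hrCoeffABHi c₁ c₂ a b ℓ q.1 q.2 * Φlo q)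

/-- **Odd head cell rule, regular points.** Cell start strictly above the unitarity bound, `c` in its
box; if `Φlo` bounds the head terms of `𝔇` from below on the cell, `oddHeadCellSumI ≥ 0`, and every
term off `F` on the descendant range is non-negative for `E ∈ [a+n, b+n]`, then `OddPositive` at every
REGULAR `Δ ∈ [a, b]` (`Δ ≠ 1` if `ℓ = 0`). [cite: DolanOsborn2004, §3 eq. (3.12)] -/
theorem oddPositive_ofPoints_of_headSumI {N : ℕ} (z zb : Fin N → ℝ) (w : Fin 5 → Fin N → ℝ)
    (hz : ∀ k, z k ∈ Ioo (0 : ℝ) 1) (hzb : ∀ k, zb k ∈ Ioo (0 : ℝ) 1) {ℓ : ℕ} {a b c₁ c₂ Δσ Δε : ℝ}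
    (ha : unitarityBound3D ℓ < a) (hc1 : c₁ ≤ (Δσ - Δε) / 2) (hc2 : (Δσ - Δε) / 2 ≤ c₂)
    (F : Finset (ℕ × ℕ)) (Φlo : ℕ × ℕ → ℝ)
    (hΦ : ∀ q ∈ F, ∀ Δ ∈ Icc a b, Φlo q ≤ oddDomEval z zb w Δσ (zMono (Δ + (q.1 : ℝ)) q.2))
    (hhead : 0 ≤ oddHeadCellSumI ℓ c₁ c₂ a b F Φlo)
    (htail : ∀ q : ℕ × ℕ, q ∉ F → InDescendantRange ℓ q.1 q.2 →
      ∀ E ∈ Icc (a + q.1) (b + q.1), 0 ≤ oddDomEval z zb w Δσ (zMono E q.2)) :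
    ∀ Δ ∈ Icc a b, IsRegularPoint3D Δ ℓ → (ℓ = 0 → Δ ≠ 1) →
      (CrossingFunctional.ofPoints z zb w).OddPositive Δσ Δε Δ ℓ := by
  intro Δ hΔ hreg h1
  have hlt : unitarityBound3D ℓ < Δ := lt_of_lt_of_le ha hΔ.1
  refine oddPositive_ofPoints_of_dom_head z zb w hz hzb hlt hreg.2 h1 F ?_ ?_
  · have hlam : 0 < legendreLam ℓ := legendreLam_pos ℓ
    have hterm : ∀ q ∈ F,
        (1 / legendreLam ℓ) * min (hrCoeffABLo c₁ c₂ a b ℓ q.1 q.2 * Φlo q)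
            (hrCoeffABHi c₁ c₂ a b ℓ q.1 q.2 * Φlo q) ≤
          hrCoeffAB ((Δσ - Δε) / 2) ((Δσ - Δε) / 2) Δ ℓ q.1 q.2 / legendreLam ℓ *
            oddDomEval z zb w Δσ (zMono (Δ + (q.1 : ℝ)) q.2) := by
      intro q hq
      have hA := hrCoeffAB_self_mem_Icc_interval ha hΔ.1 hΔ.2 hc1 hc2 q.1 q.2
      have hmin := min_mul_le_mul_of_bounds hA.2.1 hA.2.2 (hA.1.trans hA.2.1) (hΦ q hq Δ hΔ)
      have hrw : hrCoeffAB ((Δσ - Δε) / 2) ((Δσ - Δε) / 2) Δ ℓ q.1 q.2 / legendreLam ℓ *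
          oddDomEval z zb w Δσ (zMono (Δ + (q.1 : ℝ)) q.2) =
          (1 / legendreLam ℓ) * (hrCoeffAB ((Δσ - Δε) / 2) ((Δσ - Δε) / 2) Δ ℓ q.1 q.2 *
            oddDomEval z zb w Δσ (zMono (Δ + (q.1 : ℝ)) q.2)) := by ring
      rw [hrw]
      exact mul_le_mul_of_nonneg_left hmin (by positivity)
    calc (0 : ℝ) ≤ (1 / legendreLam ℓ) * oddHeadCellSumI ℓ c₁ c₂ a b F Φlo :=
          mul_nonneg (by positivity) hhead
      _ = ∑ q ∈ F, (1 / legendreLam ℓ) * min (hrCoeffABLo c₁ c₂ a b ℓ q.1 q.2 * Φlo q)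
            (hrCoeffABHi c₁ c₂ a b ℓ q.1 q.2 * Φlo q) := by
          rw [oddHeadCellSumI, Finset.mul_sum]
      _ ≤ _ := Finset.sum_le_sum hterm
  · intro q hq hr
    exact htail q hq hr (Δ + (q.1 : ℝ)) ⟨by linarith [hΔ.1], by linarith [hΔ.2]⟩

/-- **Odd head cell rule, half-open cell**: every `Δ ∈ [a, b)`, non-regular points by the limit
clause from the regular points to their right inside the cell; `ℓ = 0` cells must avoid `Δ = 1`
(`1 < a` or `b ≤ 1`). [cite: DolanOsborn2004, §3 eq. (3.12)] -/
theorem oddPositive_ofPoints_of_headSumI_Ico {N : ℕ} (z zb : Fin N → ℝ) (w : Fin 5 → Fin N → ℝ)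
    (hz : ∀ k, z k ∈ Ioo (0 : ℝ) 1) (hzb : ∀ k, zb k ∈ Ioo (0 : ℝ) 1) {ℓ : ℕ} {a b c₁ c₂ Δσ Δε : ℝ}
    (ha : unitarityBound3D ℓ < a) (h1 : ℓ = 0 → 1 < a ∨ b ≤ 1) (hc1 : c₁ ≤ (Δσ - Δε) / 2)
    (hc2 : (Δσ - Δε) / 2 ≤ c₂) (F : Finset (ℕ × ℕ)) (Φlo : ℕ × ℕ → ℝ)
    (hΦ : ∀ q ∈ F, ∀ Δ ∈ Icc a b, Φlo q ≤ oddDomEval z zb w Δσ (zMono (Δ + (q.1 : ℝ)) q.2))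
    (hhead : 0 ≤ oddHeadCellSumI ℓ c₁ c₂ a b F Φlo)
    (htail : ∀ q : ℕ × ℕ, q ∉ F → InDescendantRange ℓ q.1 q.2 →
      ∀ E ∈ Icc (a + q.1) (b + q.1), 0 ≤ oddDomEval z zb w Δσ (zMono E q.2)) :
    ∀ Δ ∈ Ico a b, (CrossingFunctional.ofPoints z zb w).OddPositive Δσ Δε Δ ℓ := by
  intro Δ hΔ
  have hreg := oddPositive_ofPoints_of_headSumI z zb w hz hzb ha hc1 hc2 F Φlo hΦ hhead htail
  have h1' : ∀ Δ' ∈ Ico a b, ℓ = 0 → Δ' ≠ 1 := by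
    intro Δ' hΔ' hℓ
    rcases h1 hℓ with h | h
    · exact ne_of_gt (by linarith [hΔ'.1])
    · exact ne_of_lt (by linarith [hΔ'.2])
  by_cases hr : IsRegularPoint3D Δ ℓ
  · exact hreg Δ ⟨hΔ.1, hΔ.2.le⟩ hr (h1' Δ hΔ)
  · have hbd : unitarityBound3D ℓ ≤ Δ := ha.le.trans hΔ.1
    refine oddPositive_ofPoints_of_eventually_right z zb w hz hzb Δσ Δε Δ ℓ hr ?_
    filter_upwards [eventually_isRegularPoint3D_nhdsGT_of_bound_le hbd, Ioo_mem_nhdsGT hΔ.2]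
      with Δ' hΔ'reg hΔ'
    exact ⟨hΔ'reg, hreg Δ' ⟨hΔ.1.trans hΔ'.1.le, hΔ'.2.le⟩ hΔ'reg
      (h1' Δ' ⟨hΔ.1.trans hΔ'.1.le, hΔ'.2⟩)⟩

/-- The odd head-cell number with CORNER term bounds on the canonical head set:
`Φlo_{n,j} = cornerBound₂ (w⁴-w⁵-|w³|) (w⁴+w⁵+|w³|) j (a+n) (b+n) σ_lo σ_hi`.
[cite: DolanOsborn2004, §3 eq. (3.12)] -/
def oddHeadNumber {N : ℕ} (z zb : Fin N → ℝ) (w : Fin 5 → Fin N → ℝ) (ℓ : ℕ)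
    (c₁ c₂ a b σlo σhi : ℝ) (nF : ℕ) : ℝ :=
  oddHeadCellSumI ℓ c₁ c₂ a b (headSet ℓ nF) (fun q =>
    cornerBound₂ (fun k => w 3 k - w 4 k - |w 2 k|) (fun k => w 3 k + w 4 k + |w 2 k|) z zb q.2
      (a + q.1) (b + q.1) σlo σhi)

/-- **One odd light-block cell from its number.** In the dominated configuration (apex `a₀`), for
`(Δ_σ, Δ_ε) ∈ Q ⊆ [σ_lo,σ_hi] × [ε_lo,ε_hi]` with `(Δ_σ-Δ_ε)/2 ∈ [c₁, c₂]` on `Q`, the odd tail rules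
(M_odd) on `[E₀, E_T)` and (T_odd) (apex numbers) in force: a `Δ`-cell `[a, b)` starting strictly
above the unitarity bound with `a ≥ ℓ + τ`, head level `n_F` with `a + n_F + 1 ≥ E₀`, and
`oddHeadNumber ≥ 0` give `OddPositive` at every `Δ ∈ [a, b)`, spin `ℓ` (either parity), every
`p ∈ Q`. Obligations (D2)–(D4) of `MixedObligations` are finite unions of such cells.
[cite: KosPolandSimmonsduffin2014, §3.3 eq. (3.16)] -/
theorem oddCell_of_headNumber {N : ℕ} (z zb : Fin N → ℝ) (w : Fin 5 → Fin N → ℝ)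
    (hz : ∀ k, z k ∈ Ioo (0 : ℝ) 1) (hzb : ∀ k, zb k ∈ Ioo (0 : ℝ) 1) (hord : ∀ k, zb k ≤ z k)
    (a₀ : Fin N) (qd qr : Fin N → ℝ) (hqd : ∀ k, 0 < qd k ∧ qd k ≤ 1)
    (hqr : ∀ k, 0 < qr k ∧ qr k ≤ 1)
    (hdomd : ∀ k, z k * zb k ≤ qd k ^ 2 * (z a₀ * zb a₀) ∧ z k ≤ qd k * z a₀)
    (hdomr : ∀ k, (1 - z k) * (1 - zb k) ≤ qr k ^ 2 * (z a₀ * zb a₀) ∧ 1 - zb k ≤ qr k * z a₀)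
    {Q : Set (ℝ × ℝ)} {σlo σhi εlo εhi c₁ c₂ E₀ ET τ : ℝ}
    (hQ : ∀ p ∈ Q, (σlo ≤ p.1 ∧ p.1 ≤ σhi) ∧ (εlo ≤ p.2 ∧ p.2 ≤ εhi))
    (hQc : ∀ p ∈ Q, c₁ ≤ (p.1 - p.2) / 2 ∧ (p.1 - p.2) / 2 ≤ c₂)
    (hModd : ∀ (j : ℕ) (E : ℝ), E₀ ≤ E → E < ET → (j : ℝ) + τ ≤ E → ∀ p ∈ Q,
      0 ≤ oddDomEval z zb w p.1 (zMono E j))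
    (hc : 0 ≤ w 3 a₀ - w 4 a₀ - |w 2 a₀|)
    (hTodd : apexRest (w 3) z zb a₀ qd qr σlo ET + apexRest (w 4) z zb a₀ qd qr σlo ET +
        apexRest (fun k => |w 2 k|) z zb a₀ qd qr σlo ET ≤
      (w 3 a₀ - w 4 a₀ - |w 2 a₀|) * ((1 - z a₀) * (1 - zb a₀)) ^ σhi)
    {ℓ : ℕ} {a b : ℝ} (ha : unitarityBound3D ℓ < a) (haτ : (ℓ : ℝ) + τ ≤ a)
    (h1 : ℓ = 0 → 1 < a ∨ b ≤ 1) (nF : ℕ) (hnF : E₀ ≤ a + ((nF : ℝ) + 1))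
    (hnum : 0 ≤ oddHeadNumber z zb w ℓ c₁ c₂ a b σlo σhi nF) :
    ∀ p ∈ Q, ∀ Δ ∈ Ico a b, (CrossingFunctional.ofPoints z zb w).OddPositive p.1 p.2 Δ ℓ := by
  intro p hp
  have hT := oddDomEval_nonneg_of_apex z zb w hz hzb hord a₀ qd qr hqd hqr hdomd hdomr hc hTodd
  refine oddPositive_ofPoints_of_headSumI_Ico z zb w hz hzb ha h1 (hQc p hp).1 (hQc p hp).2
    (headSet ℓ nF) _ ?_ hnum ?_
  · intro q _ Δ hΔ
    rw [oddDomEval_eq_twoWeightEval]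
    exact cornerBound₂_le _ _ z zb hz hzb q.2
      (⟨by linarith [hΔ.1], by linarith [hΔ.2]⟩ : Δ + (q.1 : ℝ) ∈ Icc (a + q.1) (b + q.1))
      ⟨(hQ p hp).1.1, (hQ p hp).1.2⟩
  · intro q hq hr E hE
    have h2 : (q.2 : ℝ) ≤ (ℓ : ℝ) + q.1 := by exact_mod_cast hr.2.1
    have hjb : (q.2 : ℝ) + τ ≤ E := by linarith [hE.1]
    have hjE : (q.2 : ℝ) ≤ E := by
      linarith [hE.1, natCast_add_half_le_unitarityBound3D ℓ]
    have hE0 : E₀ ≤ E := (headSet_off hnF q hq hr).trans hE.1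
    by_cases hET : E < ET
    · exact hModd q.2 E hE0 hET hjb p hp
    · exact hT E (not_lt.1 hET) q.2 hjE p.1 ⟨(hQ p hp).1.1, (hQ p hp).1.2⟩

/-! ### Obligations (D3)/(D4) from cell lists -/

/-- **A covered range from cells.** If half-open cells `[t_i, t_{i+1})`, `i < m` (any real
breakpoints, no monotonicity needed), with `t_0 ≤ lo` and `hi ≤ t_m` each carry `OddPositive` on `Q`,
then so does every `Δ ∈ [lo, hi)` (discrete intermediate-value step). [folklore] -/
theorem oddPositive_of_cells {N : ℕ} (z zb : Fin N → ℝ) (w : Fin 5 → Fin N → ℝ)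
    {Q : Set (ℝ × ℝ)} {ℓ : ℕ} (t : ℕ → ℝ) (m : ℕ) {lo hi : ℝ}
    (hlo : t 0 ≤ lo) (hhi : hi ≤ t m)
    (hcell : ∀ i < m, ∀ p ∈ Q, ∀ Δ ∈ Ico (t i) (t (i + 1)),
      (CrossingFunctional.ofPoints z zb w).OddPositive p.1 p.2 Δ ℓ) :
    ∀ p ∈ Q, ∀ Δ : ℝ, lo ≤ Δ → Δ < hi →
      (CrossingFunctional.ofPoints z zb w).OddPositive p.1 p.2 Δ ℓ := by
  intro p hp Δ h1 h2
  have hΔm : Δ < t m := lt_of_lt_of_le h2 hhi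
  have h0 : t 0 ≤ Δ := hlo.trans h1
  -- the last index `i` with `t i ≤ Δ`
  classical
  have hex : ∃ i, i < m ∧ t i ≤ Δ ∧ Δ < t (i + 1) := by
    by_contra hne
    push Not at hne
    have key : ∀ i, i ≤ m → t i ≤ Δ := by
      intro i
      induction i with
      | zero => intro _; exact h0
      | succ i ih =>
        intro hi'
        exact hne i (by omega) (ih (by omega))
    exact absurd (key m le_rfl) (not_le.2 hΔm)
  obtain ⟨i, him, hi1, hi2⟩ := hex
  exact hcell i him p hp Δ ⟨hi1, hi2⟩

end Literature.MathematicalPhysics.QuantumFieldTheory.ConformalBootstrap3D
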